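import Summits.NavierStokesRegularity.NavierStokesRegularity.Theses.LandauTail
import Literature.Analysis.FluidPDE.HomogeneousEuler
import HarnessLib.Audit

/-!
# Line `frozen-rigidity` — crux `LandauTail.LandauTailBlowup` (stmt-NavierStokesRegularity-1944)

Crux-strategist line (seat `planner-cstrat-stmt-NavierStokesRegularity-1944-h1-0`, 2026-08-17), an
ALTERNATIVE to the registered birth line `Lines/birth.lean` (cut Local ∧ Transfer). Tree path
`Cruxes/LandauTailBlowup/Lines/frozen-rigidity.lean`; card `Lines/frozen-rigidity.md`.

THE CUT (three registered stubs; composition `LandauTailBlowup_of` kernel-checked, concluding the crux BY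
NAME; the only placeholders are the three `stub_*`):

* `stub_frozenProfileLocal` (S1, ∃, XL/open — the SINGULARITY MODEL WITH AN UNNAMED PROFILE): for every
  ε > 0 there is a classical NS solution (ν = 1) on ℝ³ × (−1,0) with Tsai / Albritton–Barker local energy
  bounds in B₁ whose parabolic rescaling √(−t)·u(t, √(−t)y) converges (y ≠ 0) to SOME profile V, smooth off
  the origin, nonzero, with junk value normalised to V 0 = 0, which solves LERAY'S BACKWARD PROFILE SYSTEM
  WITH RATE a = 1/2 OFF THE ORIGIN (a "punctured Leray profile", pressure Q) and has spatial envelope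
  ‖y‖‖V y‖ ≤ ε. It does NOT assert that V is homogeneous / steady / Landau: "why the frozen profile is a
  Landau solution" is moved into S2. (The punctured profile system is what C²_loc(ℝ³∖{0})-convergence of the
  rescaled solution forces on any limit — time-averaged rescaled equation —; as an ∃-statement the clause
  is the constructor's obligation. Small envelope ⇔ small Landau flux: ‖rU^b‖_∞ ↓ 0 as |b| ↓ 0,
  Miura–Tsai 2012 p. 3.)
* `stub_puncturedLerayRigiditySmall` (S2, ∀, L-sized, PROVABLE IN PRINCIPLE — "Miura–Tsai Cor. 1.5 for
  Leray's profile equation"): there is ε₀ > 0 such that every punctured Leray profile (ν = 1, a = 1/2,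
  smooth off 0, profile system + incompressibility off 0) with envelope ‖y‖‖V y‖ ≤ ε₀ on ℝ³ ∖ {0} is
  homogeneous of degree −1 off the origin — hence (Euler's relation kills the Leray term) a steady
  Navier–Stokes flow off 0, i.e. a Landau solution (Šverák 2011). Steady sibling PROVED in print:
  Miura–Tsai, JMFM 14 (2012) = arXiv:0810.2004, Thm 1.1 / Cor 1.3 / Cor 1.5 (Šverák's Conjecture 1.4 for
  small C_*), Korolev–Šverák arXiv:0711.0560. The Leray drift a(V + y·∇V) is a coercive lower-order
  perturbation on bounded punctured balls (Kim–Kozono step) and supplies the Gaussian-weighted energy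
  identity that replaces the (unavailable) scaling globalisation of the steady proof (NRŠ 1996 / Tsai 1998;
  Pineau–Vicol arXiv:2607.09619 §5 weighted-L² framework, insensitive to the head-pressure maximum
  principle, which fails at the puncture).
* `stub_landauTailTransfer` (S3 = route item stmt-NavierStokesRegularity-1948 BY NAME, L/open): the
  localisation Local → Clay data, shared with the birth line.

Composition: S2 gives ε₀; S1 at ε₀ gives (u,p,V,Q); S2 makes V (−1)-homogeneous off 0; Euler's relation
`DV(y)y = −V(y)` (tree lemma `Literature.Analysis.FluidPDE.fderiv_apply_self_of_smul_eq_rpow_smul`) cancels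
`(1/2)V + (1/2)(y·∇)V` in the profile equation, leaving steady NS off 0 with pressure Q; with `V 0 = 0` the
homogeneity clause of `LandauTailLocal` holds for all x; the local-energy, classical and convergence clauses
are carried verbatim — this is `LandauTail.LandauTailLocal` (item 1946), and S3 turns it into the crux.
The sorry-free hypotheses form (S1 → S2 → LandauTailTransfer → LandauTailBlowup, axioms
propext/Classical.choice/Quot.sound) is landed separately as a Theorems file (`--supports` 1944).

Disproof used: no `Disproof.lean` exists for this crux (`ledger crux ls`, 2026-08-17); negatives index (4
entries) — none is an instance of S1/S2/S3. Dead lines: none recorded for this crux; the AdiabaticEddy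
corrector refutation (`not_CorrectorSolvable`, frozen COMPACTLY SUPPORTED EULER eddies admit no first-order
corrector) does not touch S1 (the frozen object here is a punctured LERAY profile with a 1/|y| tail, not a
compactly supported Euler steady state).
-/

noncomputable section

open Set Filter Topology MeasureTheory

namespace Summit.NavierStokesRegularity.NavierStokesRegularity.Cruxes.LandauTailBlowup.FrozenRigidity

open Literature.Analysis.FluidPDE
open Summit.NavierStokesRegularity.NavierStokesRegularity.Theses.LandauTail

set_option linter.dupNamespace false

/-- **stub 1 — `stub_frozenProfileLocal` (S1; ∃; XL, OPEN).** Local-energy-class first singularity at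
(0,0), ν = 1, whose parabolic rescaling freezes (pointwise off 0) onto a NONZERO punctured Leray profile
`(V, Q)` (rate 1/2, smooth off 0, `V 0 = 0`) of arbitrarily small spatial envelope `‖y‖‖V y‖ ≤ ε`. -/
theorem stub_frozenProfileLocal :
    ∀ ε : ℝ, 0 < ε → ∃ (u : ℝ → EuclideanSpace ℝ (Fin 3) → EuclideanSpace ℝ (Fin 3)) (p : ℝ → EuclideanSpace ℝ (Fin 3) → ℝ) (V : EuclideanSpace ℝ (Fin 3) → EuclideanSpace ℝ (Fin 3)) (Q : EuclideanSpace ℝ (Fin 3) → ℝ), (ContDiffOn ℝ (⊤ : ℕ∞) V {0}ᶜ ∧ ContDiffOn ℝ (⊤ : ℕ∞) Q {0}ᶜ ∧ V 0 = 0 ∧ (∀ y : EuclideanSpace ℝ (Fin 3), y ≠ 0 → -((1 : ℝ) • Laplacian.laplacian V y) + (1 / 2 : ℝ) • V y + (1 / 2 : ℝ) • fderiv ℝ V y y + Literature.Analysis.FluidPDE.convect V V y + gradient Q y = 0) ∧ (∀ y : EuclideanSpace ℝ (Fin 3), y ≠ 0 → Literature.Analysis.FluidPDE.VectorCalculus.divergence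 V y = 0) ∧ (∃ y : EuclideanSpace ℝ (Fin 3), V y ≠ 0) ∧ (∀ y : EuclideanSpace ℝ (Fin 3), y ≠ 0 → ‖y‖ * ‖V y‖ ≤ ε)) ∧ Literature.Analysis.FluidPDE.IsClassicalNSSolutionOn (Set.Ioo (-1) 0) 1 0 u p ∧ (∃ C : NNReal, ∀ t ∈ Set.Ioo (-1 : ℝ) 0, ∫⁻ x in Metric.ball (0 : EuclideanSpace ℝ (Fin 3)) 1, ‖u t x‖ₑ ^ 2 ≤ C) ∧ (∫⁻ t in Set.Ioo (-1 : ℝ) 0, ∫⁻ x in Metric.ball (0 : EuclideanSpace ℝ (Fin 3)) 1, ENNReal.ofReal (Literature.Analysis.FluidPDE.frobeniusNormSq (fderiv ℝ (u t) x)) < ⊤) ∧ (∀ y : EuclideanSpace ℝ (Fin 3), y ≠ 0 → Filter.Tendsto (fun t : ℝ => Real.sqrt (0 - t) • u t (Real.sqrt (0 - t) • y)) (nhdsWithin 0 (Set.Iio 0)) (nhds (V y))) := by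
  sorry

/-- **stub 2 — `stub_puncturedLerayRigiditySmall` (S2; ∀; L, provable in principle: Miura–Tsai 2012
Cor 1.5 transplanted to Leray's profile system).** Punctured Leray profiles (ν = 1, a = 1/2) with small
spatial envelope are homogeneous of degree −1 off the origin. -/
theorem stub_puncturedLerayRigiditySmall :
    ∃ ε : ℝ, 0 < ε ∧ ∀ (V : EuclideanSpace ℝ (Fin 3) → EuclideanSpace ℝ (Fin 3)) (Q : EuclideanSpace ℝ (Fin 3) → ℝ), ContDiffOn ℝ (⊤ : ℕ∞) V {0}ᶜ → ContDiffOn ℝ (⊤ : ℕ∞) Q {0}ᶜ → (∀ y : EuclideanSpace ℝ (Fin 3), y ≠ 0 → -((1 : ℝ) • Laplacian.laplacian V y) + (1 / 2 : ℝ) • V y + (1 / 2 : ℝ) • fderiv ℝ V y y + Literature.Analysis.FluidPDE.convect V V y + gradient Q y = 0) → (∀ y : EuclideanSpace ℝ (Fin 3), y ≠ 0 → Literature.Analysis.FluidPDE.VectorCalculus.divergence V y = 0) → (∀ y : EuclideanSpace ℝ (Fin 3), y ≠ 0 → ‖y‖ * ‖V y‖ ≤ ε) → ∀ c : ℝ,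 0 < c → ∀ y : EuclideanSpace ℝ (Fin 3), y ≠ 0 → V (c • y) = c⁻¹ • V y := by
  sorry

/-- **stub 3 — `stub_landauTailTransfer` (S3 = route item stmt-NavierStokesRegularity-1948 BY NAME; L,
OPEN).** Localisation: a local-energy-class Landau-tailed first singularity is reproduced inside a
finite-energy Leray–Hopf classical solution from a rapidly decaying datum. Shared with `Lines/birth.lean`. -/
theorem stub_landauTailTransfer :
    Summit.NavierStokesRegularity.NavierStokesRegularity.Theses.LandauTail.LandauTailTransfer := by
  sorry

/-- Euler's relation for a field homogeneous of degree −1 along the ray through `y` (tree lemma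
`fderiv_apply_self_of_smul_eq_rpow_smul` with `m = −1`, `c ^ (−1) = c⁻¹`). [folklore] -/
theorem fderiv_apply_self_of_inv_smul {V : EuclideanSpace ℝ (Fin 3) → EuclideanSpace ℝ (Fin 3)}
    {y : EuclideanSpace ℝ (Fin 3)} (hhom : ∀ c : ℝ, 0 < c → V (c • y) = c⁻¹ • V y)
    (hd : DifferentiableAt ℝ V y) : fderiv ℝ V y y = (-1 : ℝ) • V y := by
  refine fderiv_apply_self_of_smul_eq_rpow_smul (m := -1) (fun c hc => ?_) hd
  rw [Real.rpow_neg_one]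
  exact hhom c hc

/-- **Inner glue (hypotheses form, sorry-free): S1 → S2 → `LandauTailLocal`** (route item 1946). -/
theorem landauTailLocal_of_hyps
    (h1 : ∀ ε : ℝ, 0 < ε → ∃ (u : ℝ → EuclideanSpace ℝ (Fin 3) → EuclideanSpace ℝ (Fin 3)) (p : ℝ → EuclideanSpace ℝ (Fin 3) → ℝ) (V : EuclideanSpace ℝ (Fin 3) → EuclideanSpace ℝ (Fin 3)) (Q : EuclideanSpace ℝ (Fin 3) → ℝ), (ContDiffOn ℝ (⊤ : ℕ∞) V {0}ᶜ ∧ ContDiffOn ℝ (⊤ : ℕ∞) Q {0}ᶜ ∧ V 0 = 0 ∧ (∀ y : EuclideanSpace ℝ (Fin 3), y ≠ 0 → -((1 : ℝ) • Laplacian.laplacian V y) + (1 / 2 : ℝ) • V y + (1 / 2 : ℝ) • fderiv ℝ V y y + Literature.Analysis.FluidPDE.convect V V y + gradient Q y = 0) ∧ (∀ y : EuclideanSpace ℝ (Fin 3), y ≠ 0 → Literature.Analysis.FluidPDE.VectorCalculus.divergence V y = 0) ∧ (∃ y : EuclideanSpace ℝ (Fin 3), V y ≠ 0) ∧ (∀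 y : EuclideanSpace ℝ (Fin 3), y ≠ 0 → ‖y‖ * ‖V y‖ ≤ ε)) ∧ Literature.Analysis.FluidPDE.IsClassicalNSSolutionOn (Set.Ioo (-1) 0) 1 0 u p ∧ (∃ C : NNReal, ∀ t ∈ Set.Ioo (-1 : ℝ) 0, ∫⁻ x in Metric.ball (0 : EuclideanSpace ℝ (Fin 3)) 1, ‖u t x‖ₑ ^ 2 ≤ C) ∧ (∫⁻ t in Set.Ioo (-1 : ℝ) 0, ∫⁻ x in Metric.ball (0 : EuclideanSpace ℝ (Fin 3)) 1, ENNReal.ofReal (Literature.Analysis.FluidPDE.frobeniusNormSq (fderiv ℝ (u t) x)) < ⊤) ∧ (∀ y : EuclideanSpace ℝ (Fin 3), y ≠ 0 → Filter.Tendsto (fun t : ℝ => Real.sqrt (0 - t) • u t (Real.sqrt (0 - t) • y)) (nhdsWithin 0 (Set.Iio 0)) (nhds (V y))))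
    (h2 : ∃ ε : ℝ, 0 < ε ∧ ∀ (V : EuclideanSpace ℝ (Fin 3) → EuclideanSpace ℝ (Fin 3)) (Q : EuclideanSpace ℝ (Fin 3) → ℝ), ContDiffOn ℝ (⊤ : ℕ∞) V {0}ᶜ → ContDiffOn ℝ (⊤ : ℕ∞) Q {0}ᶜ → (∀ y : EuclideanSpace ℝ (Fin 3), y ≠ 0 → -((1 : ℝ) • Laplacian.laplacian V y) + (1 / 2 : ℝ) • V y + (1 / 2 : ℝ) • fderiv ℝ V y y + Literature.Analysis.FluidPDE.convect V V y + gradient Q y = 0) → (∀ y : EuclideanSpace ℝ (Fin 3), y ≠ 0 → Literature.Analysis.FluidPDE.VectorCalculus.divergence V y = 0) → (∀ y : EuclideanSpace ℝ (Fin 3), y ≠ 0 → ‖y‖ * ‖V y‖ ≤ ε) → ∀ c : ℝ, 0 < c → ∀ y : EuclideanSpace ℝ (Fin 3), y ≠ 0 → V (c • y) = c⁻¹ • V y) :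
    Summit.NavierStokesRegularity.NavierStokesRegularity.Theses.LandauTail.LandauTailLocal := by
  obtain ⟨ε, hε, hrig⟩ := h2
  obtain ⟨u, p, V, Q, ⟨hV, hQ, hV0, heq, hdiv, hne, henv⟩, hcl, hE, hD, hconv⟩ := h1 ε hε
  have hhom : ∀ c : ℝ, 0 < c → ∀ y : EuclideanSpace ℝ (Fin 3), y ≠ 0 → V (c • y) = c⁻¹ • V y :=
    hrig V Q hV hQ heq hdiv henv
  refine ⟨u, p, V, Q, ⟨hV, hQ, ?_, hdiv, ?_, hne⟩, hcl, hE, hD, hconv⟩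
  · intro x hx
    have hdiff : DifferentiableAt ℝ V x :=
      (hV.differentiableOn (by simp)).differentiableAt (isOpen_compl_singleton.mem_nhds hx)
    have hEul : fderiv ℝ V x x = (-1 : ℝ) • V x :=
      fderiv_apply_self_of_inv_smul (fun c hc => hhom c hc x hx) hdiff
    have h0 := heq x hx
    rw [hEul, one_smul] at h0
    have key : (1 / 2 : ℝ) • V x + (1 / 2 : ℝ) • ((-1 : ℝ) • V x) = 0 := by
      rw [smul_smul, ← add_smul]; norm_num
    calc Literature.Analysis.FluidPDE.convect V V x + gradient Q x
        = (-(Laplacian.laplacian V x) + (1 / 2 : ℝ) • V x + (1 / 2 : ℝ) • ((-1 : ℝ) • V x) +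
            Literature.Analysis.FluidPDE.convect V V x + gradient Q x) + Laplacian.laplacian V x -
            ((1 / 2 : ℝ) • V x + (1 / 2 : ℝ) • ((-1 : ℝ) • V x)) := by abel
      _ = (1 : ℝ) • Laplacian.laplacian V x := by rw [h0, key]; simp
  · intro c hc x
    by_cases hx : x = 0
    · subst hx; simp [hV0]
    · exact hhom c hc x hx

/-- **Composition (the skeleton theorem).** The crux BY NAME from the three registered stubs:
S3 applied to the `LandauTailLocal` witness assembled from S1 and S2. -/
theorem LandauTailBlowup_of :
    Summit.NavierStokesRegularity.NavierStokesRegularity.Theses.LandauTail.LandauTailBlowup :=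
  stub_landauTailTransfer (landauTailLocal_of_hyps stub_frozenProfileLocal stub_puncturedLerayRigiditySmall)

end Summit.NavierStokesRegularity.NavierStokesRegularity.Cruxes.LandauTailBlowup.FrozenRigidity
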